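import Literature.MathematicalPhysics.QuantumFieldTheory.Balaban1983to89.B9Eq3105Coords
import Literature.MathematicalPhysics.QuantumFieldTheory.Balaban1983to89.B9Thm37GpTorusRegularCubes
import Literature.MathematicalPhysics.QuantumFieldTheory.Balaban1983to89.B9CubeLettersInvWriteDictB
import Literature.MathematicalPhysics.QuantumFieldTheory.Balaban1983to89.B9CubeLettersInvReadDictBMajorants

/-!
# `Balaban1983to89.B9Thm310GTorusRegular` — T. Bałaban, *Propagators for lattice gauge theories in a background field*, Commun. Math. Phys.
# **99** (1985) 389–434 [Balaban1985BackgroundPropagators], Theorem 3.10 (3.105)–(3.107) pp. 414–416 ⇒ the first inequality (3.42) of Theorem 3.3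
# for `G(U) = Δ_a(U)⁻¹` AT def-Y's BOND CARRIER: the summation of [4] Prop. 2.2 ((2.64)–(2.66)) INSTANTIATED at the real coordinates `FBondY i × ι`
# of the member's `𝔸`-valued bond functions, fed by (3.105) in real coordinates (p38's `B9Eq3105Coords.eq3105_conj`), and the result WRITTEN back as the
# (3.42)₁ line over the gauge-invariant test class — the bond-sector twin of p21's `B9Thm37GpTorusRegular` ∕ `…Cubes` (sub-row G-B9-LETTERS, module M5.7 FILE 1-B)

statement-level skeleton of published theorems with citation tags; proofs where landed; nothing here is a claim about the Yang–Mills mass gap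

PDF held: `paper:balaban1985-cmp99-background-propagators` (journal page = PDF page + 388); pp. 397, 399, 409–410, 414–416 read from the held text layer.

THE PRINT.  p. 414 (3.105): *«Δ_aG₀ = I − Σ_□K(h_□)G_□h_□ − Σ_□(1 − ζ_□̃)DPD*h_□G_□h_□ − Σ_□ζ_□̃(DPD* − DP_□D*)h_□G_□h_□ − Σ_□ζ_□̃P_{□,1}(∂h_□)G_□h_□ = I − R»*,
*«The operator K(h_□)G_□h_□ satisfies the inequality (3.89), hence it is small. Next we will analyze the other operators in R and we will prove that they are
small also. More exactly, it will follow from this analysis that R satisfies the bound (3.85) with O(M⁻¹) instead of O(α₁). For M sufficiently large this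
implies G = G₀(I − R)⁻¹ = Σ_{n=0}^∞ G₀Rⁿ. (3.106)»*; p. 415: *«Thus we have decomposed R and G into convergent expansions, the terms in the expansion of R
being small»*; p. 416, Theorem 3.10: *«For M sufficiently large, and a configuration U satisfying (3.95), the operator G can be represented … The expansion
converges in all the norms appearing in (3.42)–(3.47). … Theorem 3.10 implies Theorem 3.3»*; p. 399, Theorem 3.3: *«the operator G(U) (a = 1) satisfies the
inequalities (3.42)–(3.47), with G′(U) replaced by G(U) and λ replaced by a function J defined at bonds»*; p. 397 (3.42)₁: *«|(G′(U)λ)(x)| ≦ B₀(Lʲη)²e^{−δ₀d(y,y′)}|λ|»*;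
p. 409 (3.87): *«G₀ = Σ_{□∈𝒟} h_□G_□h_□»*; p. 410: *«follows simply from Corollary 3.6 holding for all G′_□, □ ∈ 𝒟, from the bound (3.89) and Lemma 2.1. The
arguments are exactly the same as in proofs of Proposition 1.2 [3] and Proposition 2.2 [4]»*; [4] = [Balaban1984PropagatorsII] (2.51)–(2.52) p. 232,
Prop. 2.2 (2.64)–(2.67) p. 234.

WHY THIS FILE (cell context: G-B9-LETTERS, module M5.7 «(3.105) assembly ⇒ Thm 3.10 ⇒ Thm 3.3 for G(U) at def-Y's letters», FILE 1-B of `lit-balaban-p38/PLAN-M57-g38.md`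
§3; the E′-loc chain of this seat — `B9Eq3104CommutatorSizesLoc`, `B9Thm310CommutatorBound389BLoc`, `…LocOfInv`, `B9Thm310CommutatorDataOfPlaquettes` — supplies
the j-UNIFORM (3.89) majorant of the first family `K(h_□)G_□h_□`).  p21's M5.5 FILE 1 instantiated r06's kernel-checked summation `B9Thm37Sum.thm37_entry1` at the
SITE carrier for `G′(U)`; the bond sector differs in three points, all handled here: (a) NO unit weights (def-Y's bond functors carry `c_f` inside the covariant
differences, `B9CubeLettersInvWriteDictB`), so the letters are conjugated as they stand: `G := conj b G(U)`, `Δ := conj b Δ_a(U)`, `T_□ := h_□·conj b G_□(U)·h_□`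
with the cut-off read on bonds at the initial point (`hBdY`, print's `h(b₋)`) as r06's `mulOp`; (b) the remainder of (3.105) has FOUR families, two of which
(`(1 − ζ_□̃)DPD*h_□G_□h_□`, `ζ_□̃(DPD* − DP_□D*)h_□G_□h_□`) are NOT localized on the observation side before the walk re-expansion of `P` (p. 415) — so the
summation is re-run from [4] (2.64)–(2.66) (`B6RandomWalk.majorant_of_fixedPoint_266`) with the TOTAL remainder's majorant `Θ·e^{−δ₀d}` as ONE displayed input
(`thm310_entry1`; the count `N′θ` of `thm37_entry1` is the special case of observation-side localized families, and `hasMajorant_localSum_right` is the tool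
for source-side localized ones); (c) the algebraic inputs are def-Y's: `GΔ_a = 1` from `IsUnit (Δ_a(U))` (`B9Eq3105Coords.conj_GAY_mul_deltaAY`) and (3.105) in
real coordinates VERBATIM (`B9Eq3105Coords.eq3105_conj`, under `IsUnit (Δ_{a,□}(U))` for every cube and `ζ_□̃ = 1` on `supp h_□`).  The `hT` input (Cor. 3.6 for
`G_□(U)`, entry (3.42)₁) is manufactured from the cube letter's (3.42) block over the class (`B9CubeLettersInvReadDictBMajorants.hasMajorant_conj_G_of_eBlockInvB`)
and localized to p21's sets `SQT □` (overlap `3·5^{d+1}`, `hcnt_SQT`) by r06's `hasMajorant_sandwich_local`; the output majorant is WRITTEN back pointwise over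
the bond test class (`B9CubeLettersInvWriteDictB.norm_apply_le_of_hasMajorant_testYB`) and as the `e 0` entry of `kernelFamilyBInv … (GAY i parS parB Gp) …`.

WHAT IS PROVED (all `theorem`s, 0 `def`, 0 sorry).  §1 (generic lattice `X`, geometry `g`) ★ `thm310_entry1` (G = G₀ + GR, G₀ = Σ_□T_□ localized with overlap
≤ N, R with majorant Θe^{−δ₀d}, Θc₁(α) < 1 ⇒ G has majorant N·B₀c₁(α)(1 − Θc₁(α))⁻¹·ℓ²·e^{−(1−α)δ₀d}), `thm310_entry1_explicit` (Θ = Θ₀M⁻¹, 2Θ₀c₁(α) ≤ M ⇒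
constant 2NB₀c₁(α)), `hasMajorant_localSum_right`; §2 ★★ `hasMajorant_conj_GAY_of_cubes`
(def-Y: the majorant of `conj b G(U)` from the cube terms' localized majorants `hT`, the total-remainder majorant `hR` of the four (3.105) families, `IsUnit Δ_a(U)`,
`IsUnit Δ_{a,□}(U)`); §3 `hasMajorant_cut_sandwichB`, ★ `hT_of_eBlockInvB_cube` (the `hT` input from the cube letter's (3.42) block over the class at `SQT □`);
§4 ★★ `hasMajorant_conj_GAY_of_cubeCover` (§2 at the cover of record: `N = 3·5^{d+1}`, `B₀ ↦ M₂(Σ‖b_j‖)B₀`); §5 `norm_apply_le_of_hasMajorantB`,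
`e0_kernelFamilyBInv_le_of_hasMajorant` (the (3.42)₁ line WRITTEN from a majorant, generic letter), ★★★ `norm_GAY_apply_le_of_cubeCover` ∕ ★★★
`e0_kernelFamilyBInv_GAY_le_of_cubeCover` ((3.42)₁ for `G(U)` pointwise over the class and as the `e 0` entry, constant and rate EXPLICIT).

HONEST SCOPE.  DISPLAYED (hypotheses, each the named output of a sibling module, none a cited fact): `hE` — Cor. 3.6 ∕ Thm 3.3 for every cube letter `G_□(U)`
as its (3.42) block over the class (M5.1b ∕ M5.2 at r05's cube letters `B9CubeLettersBondOpsL0.GACubeY`); `hR` — the majorant `Θe^{−δ₀d}` of the TOTAL remainder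
`R` of (3.105) in real coordinates with `Θc₁(α) < 1` («M sufficiently large»): its first family is this seat's E′-loc chain (`…LocOfInv.hasMajorant_conj_KhBY_hTY_of_eBlockInvB_fac_loc`
+ `…DataOfPlaquettes`, per cube, observation-side localized), families 2–3 need print's walk re-expansion of `P` (p. 415; cell GAPS G-B9-05∕06a) and family 4 the
(3.101) smallness of `P_{□,1}(∂h)` (G-B9-07) — NOT supplied here; `hinvC : ∀ □, IsUnit (Δ_{a,□}(U))` (r05's `B9Thm311CubeLettersG.isUnit_deltaACubeY_parSymY_pureGauge` ∕
`…_all_of_smallFieldGauge` reduce it to (3.86)) and `hinvU : IsUnit (Δ_a(U))` (Thm 3.3's regime; M5.3 lineage); the five geometric inputs (p21's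
`B9Thm37GpTorusRegular.geo_inputs_geo9K` above its threshold).  Corner-free members (a section `ιB` of `β`).  Entries (3.42)₂₋₄ ∕ (3.43)–(3.47) for `G(U)` are the
later files of M5.7.  Nothing continuum ∕ OS ∕ mass gap ∕ Clay; YM mass gap NOT proved by any of this (Track A conditional rung).  `--supports stmt-QuantumFields-19200`.
Net new unproved facts: 0.
-/

noncomputable section

namespace Literature.MathematicalPhysics.QuantumFieldTheory.Balaban1983to89.B9Thm310GTorusRegular

open Node00 B9CubeLettersInvReadings
open B9CubeLettersInvReadDict (iSup_testY_le)
open B9CubeLettersInvReadDictB (supInB_le)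
open B9CubeLettersInvReadDictBMajorants (hasMajorant_conj_G_of_eBlockInvB)
open B9CubeLettersInvWriteDictB (norm_apply_le_of_hasMajorant_testYB)
open Node00.OpsYRead342 (geo9K_len_congr geo9K_dist_congr)
open B6GlobalChartV1 (blkV1)
open B6Ineq2142KLevelV1 (β)
open B6KLevelCensusIndexV1 (KIdx)
open B6Cover236MultiLevelBlocks (cubes)
open B6RandomWalk (HasMajorant Triangle254 Ineq261 Ineq263 hasMajorant_mono)
open B9Thm34Ext (toB6)
open B9FromB6 (EBlock)
open B9GeoNormsKLevelV1 (geo9K geo9K_supNorm_nonneg)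
open B9Eq352DivFormLetters (conj)
open B9Thm37Sum (mulOp mulOp_apply hasMajorant_sandwich_local hasMajorant_localSum hasMajorant_finsetSum fixedPoint_of_388)
open B9Thm37CubeCoverCommutators (cutMulY hTY)
open B9Eq3104CutoffCommutators (hBdY KhBY DPDsY)
open B9CubeLettersBondOpsL0 (deltaACubeY GACubeY)
open B9Eq3105AtLetters (DPDsCubeY P1CubeY)
open B9Eq3105Coords (eq3105_conj conj_GAY_mul_deltaAY)
open B9Thm37GpTorusRegularCubes (SQT mem_SQT hcnt_SQT)
open B9Thm37CubeCoverCommutatorSizes (side_conditions four_le_P')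
open scoped Matrix

/-! ## §1 [4] Prop. 2.2 (2.64)–(2.66) with the cube terms localized and the remainder's majorant supplied whole — the summation behind (3.106) -/

section Generic

variable {g : B9.Geometry} [Fintype g.Site] [DecidableEq g.Site] {R : ℝ} {H : Prop} {X : Type}

/-- **SUMS OF SOURCE-SIDE LOCALIZED OPERATORS**: if every `T_k` has the majorant `K(y,y′)·χ_k(y′)` with a common `K ≥ 0` (localisation on the side of
`supp λ ⊂ Δ(y′)` — e.g. an operator `⋯h_□` whose rightmost factor is the cut-off) and `Σ_k χ_k(y′) ≤ N`, then `Σ_k T_k` has the majorant `N·K` — the twin of r06's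
observation-side `B9Thm37Sum.hasMajorant_localSum` ([4] p. 232 «A summation preserves it also»). [cite: Balaban1984PropagatorsII, (2.51)–(2.52) p.232; Balaban1985BackgroundPropagators, (3.105) p.414] -/
theorem hasMajorant_localSum_right {Gb : B6.Geometry} (blk : X → Gb.Site) {κ : Type} [Fintype κ]
    (T : κ → Module.End ℝ (X → ℝ)) (χ : κ → Gb.Site → ℝ) (K : Gb.Site → Gb.Site → ℝ) (N : ℝ)
    (hK : ∀ a a', 0 ≤ K a a') (hT : ∀ k, HasMajorant blk (T k) (fun a a' => K a a' * χ k a'))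
    (hN : ∀ a', ∑ k, χ k a' ≤ N) :
    HasMajorant blk (∑ k, T k) (fun a a' => N * K a a') := by
  refine hasMajorant_mono blk (hasMajorant_finsetSum blk Finset.univ T _ fun k _ => hT k) fun a a' => ?_
  calc (∑ k, K a a' * χ k a') = K a a' * ∑ k, χ k a' := by rw [Finset.mul_sum]
    _ ≤ K a a' * N := mul_le_mul_of_nonneg_left (hN a') (hK a a')
    _ = N * K a a' := mul_comm _ _

variable [Fintype X] [DecidableEq X]

/-- ★ **THEOREM 3.10'S SUMMATION FOR THE FIRST ENTRY — (3.106) `G = G₀(I − R)⁻¹` ESTIMATED BY [4] PROP. 2.2, THE REMAINDER'S MAJORANT SUPPLIED WHOLE**: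
`G·Δ = 1` (`hinv`), `Δ·Σ_□T_□ = 1 − R` ((3.105), `h388`), every cube term `T_□` (= `h_□G_□h_□`) with the LOCALIZED majorant `1_{S_□}(y)·B₀ℓ(y)²e^{−δ₀d(y,y′)}`
(Cor. 3.6 for `G_□`, `hT`) of bounded overlap `Σ_□1_{S_□} ≤ N` (`hcnt`), the TOTAL remainder `R` with the majorant `Θ·e^{−δ₀d(y,y′)}` (`hR`; p. 414 «R satisfies the
bound (3.85) with O(M⁻¹) instead of O(α₁)»), [4] Lemma 2.1 at exponent `α` ((2.61) `h261`, (2.63) `h263`, (2.54) `htri`) and the located smallness `Θc₁(α) < 1`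
(«For M sufficiently large») give `G` the majorant `N·B₀c₁(α)(1 − Θc₁(α))⁻¹·ℓ(y)²·e^{−(1−α)δ₀d(y,y′)}` — mechanism `B9Thm37Sum.hasMajorant_localSum` +
`fixedPoint_of_388` + `B6RandomWalk.majorant_of_fixedPoint_266`, exactly as in r06's `thm37_entry1` (whose `N′θ` is the observation-side localized case of `Θ`).
[cite: Balaban1985BackgroundPropagators, (3.105)–(3.106) p.414, Thm 3.10 p.416, Thm 3.7 proof p.410; Balaban1984PropagatorsII, Prop. 2.2 (2.64)–(2.67) p.234] -/
theorem thm310_entry1 (blk : X → g.Site) (d : ℕ) (δ₀ α Θ B₀ N : ℝ) {κ : Type} [Fintype κ]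
    (S : κ → Finset g.Site) (Tl : κ → Module.End ℝ (X → ℝ)) {G' Δ Rt : Module.End ℝ (X → ℝ)}
    (hB₀ : 0 ≤ B₀) (hΘ : 0 ≤ Θ) (hN : 0 ≤ N) (hαδ : 0 ≤ (1 - α) * δ₀)
    (htri : Triangle254 (toB6 g R H)) (hrefl : ∀ y : g.Site, g.dist y y = 0) (hdnn : ∀ y y' : g.Site, 0 ≤ g.dist y y')
    (h261 : Ineq261 d (toB6 g R H) δ₀ α) (h263 : Ineq263 d (toB6 g R H) δ₀ α) (hsmall : Θ * B6.c1 d δ₀ α < 1)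
    (hT : ∀ k, HasMajorant (g := toB6 g R H) blk (Tl k)
      (fun (a a' : g.Site) => if a ∈ S k then B₀ * g.len a ^ 2 * Real.exp (-(δ₀ * g.dist a a')) else 0))
    (hcnt : ∀ a : g.Site, (∑ k, if a ∈ S k then (1 : ℝ) else 0) ≤ N)
    (hR : HasMajorant (g := toB6 g R H) blk Rt (fun (a a' : g.Site) => Θ * Real.exp (-(δ₀ * g.dist a a'))))
    (hinv : G' * Δ = 1) (h388 : Δ * (∑ k, Tl k) = 1 - Rt) :
    HasMajorant (g := toB6 g R H) blk G'
      (fun (a a' : g.Site) => N * B₀ * B6.c1 d δ₀ α * (1 - Θ * B6.c1 d δ₀ α)⁻¹ * g.len a ^ 2 *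
        Real.exp (-((1 - α) * δ₀ * g.dist a a'))) := by
  -- (3.87): G₀ = Σ_□ h_□G_□h_□ has majorant N·B₀ℓ²e^{−δ₀d} (localisation weights = indicators of the S_□)
  have hT' : ∀ k, HasMajorant (g := toB6 g R H) blk (Tl k)
      (fun (a a' : g.Site) => (if a ∈ S k then (1 : ℝ) else 0) * (B₀ * g.len a ^ 2 * Real.exp (-(δ₀ * g.dist a a')))) :=
    fun k => hasMajorant_mono (g := toB6 g R H) blk (hT k) fun a a' => le_of_eq (by split_ifs <;> simp)
  have hG0 : HasMajorant (g := toB6 g R H) blk (∑ k, Tl k)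
      (fun (a a' : g.Site) => N * B₀ * g.len a ^ 2 * Real.exp (-(δ₀ * g.dist a a'))) := by
    have h := hasMajorant_localSum (G := toB6 g R H) blk Tl (fun k (a : g.Site) => if a ∈ S k then 1 else 0)
      (fun (a a' : g.Site) => B₀ * g.len a ^ 2 * Real.exp (-(δ₀ * g.dist a a'))) N
      (fun a a' => mul_nonneg (mul_nonneg hB₀ (sq_nonneg _)) (Real.exp_nonneg _)) hT' hcnt
    exact hasMajorant_mono (g := toB6 g R H) blk h fun a a' => le_of_eq (by ring)
  -- (3.106) as the fixed point G = G₀ + G·R, then [4] (2.64)–(2.66)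
  have hfix : G' = (∑ k, Tl k) + G' * Rt := fixedPoint_of_388 hinv h388
  have h := B6RandomWalk.majorant_of_fixedPoint_266 (g := toB6 g R H) blk d δ₀ α Θ (N * B₀) (fun a => g.len a ^ 2)
    (mul_nonneg hN hB₀) (fun a => sq_nonneg _) hΘ hαδ htri hrefl hdnn h261 h263 hsmall hG0 hR hfix
  refine hasMajorant_mono (g := toB6 g R H) blk h fun a a' => le_of_eq ?_
  simp only [B9Thm34Ext.toB6_dist]

/-- **«FOR M SUFFICIENTLY LARGE», WITNESSED ON THIS ENTRY**: with the remainder's size `Θ = Θ₀·M⁻¹` (p. 414 «R satisfies the bound (3.85) with O(M⁻¹) instead of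
O(α₁)»; `Θ₀ > 0` depending on d, L and the constants of the cube letters) and the EXPLICIT threshold `2Θ₀c₁(α) ≤ M`: `Θ₀M⁻¹c₁(α) ≤ ½`, and `G` has the majorant
`2N·B₀c₁(α)·ℓ(y)²·e^{−(1−α)δ₀d(y,y′)}` — Theorem 3.3's «constants independent of {Ω_j} and U» on the first entry (the twin of r06's `thm37_entry1_explicit`).
[cite: Balaban1985BackgroundPropagators, Thm 3.10 p.416 («For M sufficiently large»), (3.106) p.414, Thm 3.3 p.399; Balaban1984PropagatorsII, Prop. 2.2 (2.66)–(2.67) p.234] -/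
theorem thm310_entry1_explicit (blk : X → g.Site) (d : ℕ) (δ₀ α Θ₀ B₀ N : ℝ) {κ : Type} [Fintype κ]
    (S : κ → Finset g.Site) (Tl : κ → Module.End ℝ (X → ℝ)) {G' Δ Rt : Module.End ℝ (X → ℝ)}
    (hB₀ : 0 ≤ B₀) (hΘ₀ : 0 < Θ₀) (hN : 0 ≤ N) (hαδ : 0 ≤ (1 - α) * δ₀)
    (hc₁ : 0 < B6.c1 d δ₀ α) (hM : 0 < g.M) (hM₂ : 2 * Θ₀ * B6.c1 d δ₀ α ≤ g.M)
    (htri : Triangle254 (toB6 g R H)) (hrefl : ∀ y : g.Site, g.dist y y = 0) (hdnn : ∀ y y' : g.Site, 0 ≤ g.dist y y')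
    (h261 : Ineq261 d (toB6 g R H) δ₀ α) (h263 : Ineq263 d (toB6 g R H) δ₀ α)
    (hT : ∀ k, HasMajorant (g := toB6 g R H) blk (Tl k)
      (fun (a a' : g.Site) => if a ∈ S k then B₀ * g.len a ^ 2 * Real.exp (-(δ₀ * g.dist a a')) else 0))
    (hcnt : ∀ a : g.Site, (∑ k, if a ∈ S k then (1 : ℝ) else 0) ≤ N)
    (hR : HasMajorant (g := toB6 g R H) blk Rt (fun (a a' : g.Site) => Θ₀ * g.M⁻¹ * Real.exp (-(δ₀ * g.dist a a'))))
    (hinv : G' * Δ = 1) (h388 : Δ * (∑ k, Tl k) = 1 - Rt) :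
    HasMajorant (g := toB6 g R H) blk G'
      (fun (a a' : g.Site) => 2 * N * B₀ * B6.c1 d δ₀ α * g.len a ^ 2 * Real.exp (-((1 - α) * δ₀ * g.dist a a'))) := by
  set c : ℝ := B6.c1 d δ₀ α with hcdef
  have hΘ : 0 ≤ Θ₀ * g.M⁻¹ := mul_nonneg hΘ₀.le (inv_nonneg.mpr hM.le)
  -- Θ₀ M⁻¹ c ≤ 1/2 from 2 Θ₀ c ≤ M
  have hq : Θ₀ * g.M⁻¹ * c ≤ 1 / 2 := by
    have h1 : Θ₀ * g.M⁻¹ * c = (Θ₀ * c) / g.M := by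
      rw [div_eq_mul_inv]; ring
    rw [h1, div_le_iff₀ hM]
    linarith
  have hsmall : Θ₀ * g.M⁻¹ * c < 1 := by linarith
  have hinv' : (1 - Θ₀ * g.M⁻¹ * c)⁻¹ ≤ 2 := by
    rw [inv_le_comm₀ (by linarith) (by norm_num : (0 : ℝ) < 2)]
    linarith
  have h := thm310_entry1 (R := R) (H := H) blk d δ₀ α (Θ₀ * g.M⁻¹) B₀ N S Tl hB₀ hΘ hN hαδ htri hrefl hdnn h261 h263 hsmall
    hT hcnt hR hinv h388
  refine hasMajorant_mono (g := toB6 g R H) blk h fun a a' => ?_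
  have hE : 0 ≤ g.len a ^ 2 * Real.exp (-((1 - α) * δ₀ * g.dist a a')) := mul_nonneg (sq_nonneg _) (Real.exp_nonneg _)
  have hNBc : 0 ≤ N * B₀ * c := mul_nonneg (mul_nonneg hN hB₀) hc₁.le
  have key : N * B₀ * c * (1 - Θ₀ * g.M⁻¹ * c)⁻¹ ≤ 2 * N * B₀ * c := by
    calc N * B₀ * c * (1 - Θ₀ * g.M⁻¹ * c)⁻¹ ≤ N * B₀ * c * 2 := mul_le_mul_of_nonneg_left hinv' hNBc
      _ = 2 * N * B₀ * c := by ring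
  calc N * B₀ * c * (1 - Θ₀ * g.M⁻¹ * c)⁻¹ * g.len a ^ 2 * Real.exp (-((1 - α) * δ₀ * g.dist a a'))
      = N * B₀ * c * (1 - Θ₀ * g.M⁻¹ * c)⁻¹ * (g.len a ^ 2 * Real.exp (-((1 - α) * δ₀ * g.dist a a'))) := by ring
    _ ≤ 2 * N * B₀ * c * (g.len a ^ 2 * Real.exp (-((1 - α) * δ₀ * g.dist a a'))) := mul_le_mul_of_nonneg_right key hE
    _ = _ := by ring

end Generic

variable {d ℓ : ℕ} {hd : 1 ≤ d + 1} {hL : Odd (ℓ + 1) ∧ 1 < ℓ + 1} {b₀ b₁ : ℝ}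
variable {𝔸 : Type} [NormedRing 𝔸] [NormedAlgebra ℂ 𝔸] [CompleteSpace 𝔸]
variable {ι : Type} [Fintype ι] [DecidableEq ι]
variable (i : KIdx d ℓ hd hL b₀ b₁) (b : Module.Basis ι ℝ 𝔸)
variable [Fintype (geo9K i).Site] [DecidableEq (geo9K i).Site] {Rr : ℝ} {Hp : Prop}
variable (ιB : BlkY i → IBondY i)

/-! ## §2 Theorem 3.10 ⇒ the (3.42)₁ majorant of `conj b G(U)` at def-Y's bond carrier, from (3.105) in real coordinates -/

section DefY

/-- ★★ **THEOREM 3.10 ⇒ THE FIRST (3.42) MAJORANT FOR def-Y's `G(U) = Δ_a(U)⁻¹`, AT THE BOND CARRIER** (p. 416 «Theorem 3.10 implies Theorem 3.3»; p. 414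
(3.105)–(3.106)): for def-Y's letters at a configuration `U` with `Δ_a(U)` invertible (`hinvU`) and every `Δ_{a,□}(U)` invertible (`hinvC`), a choice `ζ_□̃ = 1`
on `supp h_□` (`hζ`), the cube terms `h_□·conj b G_□(U)·h_□` with localized majorants `1_{S_□}·B₀ℓ²e^{−δ₀d}` (Cor. 3.6 for `G_□(U)`, `hT`) of overlap ≤ `N` (`hcnt`),
the TOTAL remainder of (3.105) in real coordinates — the four printed families `Σ_□K(h_□)G_□h_□ + Σ_□(1 − ζ_□̃)DPD*(h_□G_□h_□) + Σ_□ζ_□̃(DPD* − DP_□D*)(h_□G_□h_□) +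
Σ_□ζ_□̃P_{□,1}(∂h_□)G_□h_□`, conjugated — with the majorant `Θ·e^{−δ₀d}` (`hR`), [4] Lemma 2.1 at exponent `α` for the member and `Θc₁(α) < 1`:
`conj b G(U)` has the majorant `N·B₀c₁(α)(1 − Θc₁(α))⁻¹·ℓ(a)²·e^{−(1−α)δ₀d(a,a′)}` — `thm310_entry1` at `X := FBondY i × ι`, `blk := (x, j) ↦ ιB(Δ(x))`, fed by
`B9Eq3105Coords.conj_GAY_mul_deltaAY` (`hinv`) and `B9Eq3105Coords.eq3105_conj` (`h388`, verbatim).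
[cite: Balaban1985BackgroundPropagators, Thm 3.10 p.416 + (3.105)–(3.106) p.414, (3.87) p.409, (3.27) p.395; Balaban1984PropagatorsII, Prop. 2.2 (2.64)–(2.66) p.234] -/
theorem hasMajorant_conj_GAY_of_cubes (d' : ℕ) {δ₀ α Θ B₀ N : ℝ}
    (parS : SiteParY 𝔸 i) (parB : BondParY 𝔸 i) (Gp : SiteOpY 𝔸 i) (U : CfgY 𝔸 i)
    (ζ : ↥(cubes i.D.toDomains) → SiteY i → ℝ) (hζ : ∀ c z, hTY i c z ≠ 0 → ζ c z = 1)
    (hinvC : ∀ c : ↥(cubes i.D.toDomains), IsUnit (deltaACubeY i c parS parB U)) (hinvU : IsUnit (deltaAY i parS parB Gp U))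
    (S : ↥(cubes i.D.toDomains) → Finset (geo9K i).Site)
    (hB₀ : 0 ≤ B₀) (hΘ : 0 ≤ Θ) (hN : 0 ≤ N) (hαδ : 0 ≤ (1 - α) * δ₀)
    (htri : Triangle254 (toB6 (geo9K i) Rr Hp)) (hrefl : ∀ y : (geo9K i).Site, (geo9K i).dist y y = 0)
    (hdnn : ∀ y y' : (geo9K i).Site, 0 ≤ (geo9K i).dist y y')
    (h261 : Ineq261 d' (toB6 (geo9K i) Rr Hp) δ₀ α) (h263 : Ineq263 d' (toB6 (geo9K i) Rr Hp) δ₀ α)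
    (hsmall : Θ * B6.c1 d' δ₀ α < 1)
    (hT : ∀ c, HasMajorant (g := toB6 (geo9K i) Rr Hp) (fun p : FBondY i × ι => ιB (blkV1 i.hN i.D p.1))
      (mulOp (fun p : FBondY i × ι => hBdY i (hTY i c) p.1) * conj b ((GACubeY i c parS parB U).restrictScalars ℝ) *
        mulOp (fun p : FBondY i × ι => hBdY i (hTY i c) p.1))
      (fun a a' => if a ∈ S c then B₀ * (geo9K i).len a ^ 2 * Real.exp (-(δ₀ * (geo9K i).dist a a')) else 0))
    (hcnt : ∀ a : (geo9K i).Site, (∑ c, if a ∈ S c then (1 : ℝ) else 0) ≤ N)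
    (hR : HasMajorant (g := toB6 (geo9K i) Rr Hp) (fun p : FBondY i × ι => ιB (blkV1 i.hN i.D p.1))
      ((∑ c, conj b ((KhBY i (hTY i c) parB U * GACubeY i c parS parB U * cutMulY (hBdY i (hTY i c))).restrictScalars ℝ))
        + ∑ c, conj b (((1 - cutMulY (hBdY i (ζ c))) * DPDsY i parS Gp U *
            (cutMulY (hBdY i (hTY i c)) * GACubeY i c parS parB U * cutMulY (hBdY i (hTY i c)))).restrictScalars ℝ)
        + ∑ c, conj b ((cutMulY (hBdY i (ζ c)) * (DPDsY i parS Gp U - DPDsCubeY i c parS U) *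
            (cutMulY (hBdY i (hTY i c)) * GACubeY i c parS parB U * cutMulY (hBdY i (hTY i c)))).restrictScalars ℝ)
        + ∑ c, conj b ((cutMulY (hBdY i (ζ c)) * P1CubeY i c (hTY i c) parS U * GACubeY i c parS parB U *
            cutMulY (hBdY i (hTY i c))).restrictScalars ℝ))
      (fun a a' => Θ * Real.exp (-(δ₀ * (geo9K i).dist a a')))) :
    HasMajorant (g := toB6 (geo9K i) Rr Hp) (fun p : FBondY i × ι => ιB (blkV1 i.hN i.D p.1))
      (conj b ((GAY i parS parB Gp U).restrictScalars ℝ))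
      (fun a a' => N * B₀ * B6.c1 d' δ₀ α * (1 - Θ * B6.c1 d' δ₀ α)⁻¹ * (geo9K i).len a ^ 2 *
        Real.exp (-((1 - α) * δ₀ * (geo9K i).dist a a'))) :=
  thm310_entry1 (fun p : FBondY i × ι => ιB (blkV1 i.hN i.D p.1)) d' δ₀ α Θ B₀ N S
    (fun c => mulOp (fun p : FBondY i × ι => hBdY i (hTY i c) p.1) * conj b ((GACubeY i c parS parB U).restrictScalars ℝ) *
      mulOp (fun p : FBondY i × ι => hBdY i (hTY i c) p.1))
    hB₀ hΘ hN hαδ htri hrefl hdnn h261 h263 hsmall hT hcnt hR (conj_GAY_mul_deltaAY i b parS parB Gp U hinvU)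
    (eq3105_conj i b parS parB Gp U ζ hζ hinvC)

end DefY

/-! ## §3 Manufacturing `hT`: the cut-off `h_□(b₋)` sandwich of a bond letter with a block majorant is localized to `SQT □` -/

section Sandwich

omit [CompleteSpace 𝔸] [DecidableEq ι] in
/-- **THE LOCALIZED MAJORANT OF `h·O·h` ON THE BOND CARRIER**: a block majorant `K` of `conj b O`, a real bond profile `|h| ≤ 1` whose support meets only
the blocks of `S`, give `mulOp h · conj b O · mulOp h` the majorant `1_S·K` (r06's `hasMajorant_sandwich_local` at `X := FBondY i × ι`).
[cite: Balaban1985BackgroundPropagators, (3.87) p.409 («G₀ = Σ h_□G_□h_□»), (3.100) p.413 (h(b) := h(b₋))] -/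
theorem hasMajorant_cut_sandwichB {O : Module.End ℝ (FBondY i → 𝔸)} {K : (geo9K i).Site → (geo9K i).Site → ℝ}
    (hO : HasMajorant (g := toB6 (geo9K i) Rr Hp) (fun p : FBondY i × ι => ιB (blkV1 i.hN i.D p.1)) (conj b O) K)
    (h : FBondY i → ℝ) (hh : ∀ x, |h x| ≤ 1) (S : Finset (geo9K i).Site) (hS : ∀ x, h x ≠ 0 → ιB (blkV1 i.hN i.D x) ∈ S) :
    HasMajorant (g := toB6 (geo9K i) Rr Hp) (fun p : FBondY i × ι => ιB (blkV1 i.hN i.D p.1))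
      (mulOp (fun p : FBondY i × ι => h p.1) * conj b O * mulOp (fun p : FBondY i × ι => h p.1))
      (fun a a' => if a ∈ S then K a a' else 0) :=
  hasMajorant_sandwich_local (fun p : FBondY i × ι => ιB (blkV1 i.hN i.D p.1)) hO (fun p : FBondY i × ι => h p.1)
    (fun p => hh p.1) S (fun p hp => hS p.1 hp)

variable {B : B9.Backgrounds} (cfg : B.Cfg → CfgY 𝔸 i) {U₁ : B.Cfg}

omit [DecidableEq ι] in
/-- ★ **THE `hT` INPUT AT A CUBE OF THE COVER, BOND SECTOR**: the (3.42) block over the class of a bond cube letter `O_□` at `U₁` (Cor. 3.6 ∕ Thm 3.3 for `G_□(U)`)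
gives `h_□·conj b O_□(U)·h_□` the localized majorant `1_{SQT □}·M₂(Σ‖b_j‖)B₀·ℓ²·e^{−δ₀d}` (`|h_□(b₋)| ≤ 1`; `h_□(b₋) ≠ 0 ⇒ Δ(b) ∈ QT □`:
`B6Partition118KLevelTorusCentral.blkOf_mem_QT_of_hT_ne_zero`). [cite: Balaban1985BackgroundPropagators, (3.87) p.409, Cor. 3.6 p.408, Thm 3.3 p.399; Balaban1984PropagatorsII, (2.51) p.232] -/
theorem hT_of_eBlockInvB_cube (hι : ∀ s, β i.hN i.D i.hk (ιB s) = s)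
    {M₂ : ℝ} (hM₂ : 0 ≤ M₂) (hrepr : ∀ (v : 𝔸) (j : ι), |b.repr v j| ≤ M₂ * ‖v‖)
    (O : BondOpY 𝔸 i) (par : BondParY 𝔸 i) {B₀ δ₀ : ℝ} (hB₀ : 0 ≤ B₀) (hE : EBlock (kernelFamilyBInv i B cfg O par) B₀ δ₀ U₁)
    (c : ↥(cubes i.D.toDomains)) :
    HasMajorant (g := toB6 (geo9K i) Rr Hp) (fun p : FBondY i × ι => ιB (blkV1 i.hN i.D p.1))
      (mulOp (fun p : FBondY i × ι => hBdY i (hTY i c) p.1) * conj b ((O (cfg U₁)).restrictScalars ℝ) *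
        mulOp (fun p : FBondY i × ι => hBdY i (hTY i c) p.1))
      (fun a a' => if a ∈ SQT i c then M₂ * (∑ j, ‖b j‖) * B₀ * (geo9K i).len a ^ 2 * Real.exp (-(δ₀ * (geo9K i).dist a a')) else 0) := by
  obtain ⟨_, hMh2, hR, _⟩ := side_conditions i
  have hO := hasMajorant_conj_G_of_eBlockInvB i b cfg O par (Rr := Rr) (Hp := Hp) hE hB₀ ιB hι hM₂ hrepr
    ((O (cfg U₁)).restrictScalars ℝ) (fun _ => rfl)
  refine hasMajorant_cut_sandwichB i b ιB hO (hBdY i (hTY i c)) (fun x => ?_) (SQT i c) (fun x hx => ?_)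
  · exact B6Partition118KLevelTorus.abs_hT_le_one i.D (B9GeoLemma21KLevelV1.one_le_Mh i) (B9GeoLemma21KLevelV1.one_le_P i) c _
  · refine (mem_SQT i c (ιB (blkV1 i.hN i.D x))).2 ?_
    rw [hι]
    exact B6Partition118KLevelTorusCentral.blkOf_mem_QT_of_hT_ne_zero hMh2 hR (four_le_P' i) c hx

end Sandwich

/-! ## §4 Theorem 3.10 ⇒ (3.42)₁ majorant for `G(U)` AT THE CUBE COVER OF RECORD -/

section Cover

variable {B : B9.Backgrounds} (cfg : B.Cfg → CfgY 𝔸 i) {U₁ : B.Cfg}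

/-- ★★ **THE (3.42)₁ MAJORANT OF `conj b G(U)` AT THE CUBE COVER OF RECORD**: §2 with the cube letters entering through their (3.42) blocks over the class at
`U₁` (`hE`, Cor. 3.6 ∕ Thm 3.3 for every `G_□(U)`), the localisation sets `SQT □` of overlap `3·5^{d+1}` (p21's `hcnt_SQT`), so `N = 3·5^{d+1}` and
`B₀ ↦ M₂(Σ‖b_j‖)B₀`; displayed: the total-remainder majorant `hR` (`Θe^{−δ₀d}`, `Θc₁(α) < 1`), `IsUnit Δ_{a,□}(U)` ∕ `IsUnit Δ_a(U)` at `U = cfg U₁`, the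
geometry. [cite: Balaban1985BackgroundPropagators, Thm 3.10 p.416 + (3.105)–(3.106) p.414 ⇒ Thm 3.3 p.399 (3.42)₁ p.397] -/
theorem hasMajorant_conj_GAY_of_cubeCover (hι : ∀ s, β i.hN i.D i.hk (ιB s) = s)
    {M₂ : ℝ} (hM₂ : 0 ≤ M₂) (hrepr : ∀ (v : 𝔸) (j : ι), |b.repr v j| ≤ M₂ * ‖v‖)
    (d' : ℕ) {δ₀ α Θ B₀ : ℝ}
    (parS : SiteParY 𝔸 i) (parB : BondParY 𝔸 i) (Gp : SiteOpY 𝔸 i) (par : BondParY 𝔸 i)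
    (ζ : ↥(cubes i.D.toDomains) → SiteY i → ℝ) (hζ : ∀ c z, hTY i c z ≠ 0 → ζ c z = 1)
    (hinvC : ∀ c : ↥(cubes i.D.toDomains), IsUnit (deltaACubeY i c parS parB (cfg U₁))) (hinvU : IsUnit (deltaAY i parS parB Gp (cfg U₁)))
    (hB₀ : 0 ≤ B₀) (hΘ : 0 ≤ Θ) (hαδ : 0 ≤ (1 - α) * δ₀)
    (htri : Triangle254 (toB6 (geo9K i) Rr Hp)) (hrefl : ∀ y : (geo9K i).Site, (geo9K i).dist y y = 0)
    (hdnn : ∀ y y' : (geo9K i).Site, 0 ≤ (geo9K i).dist y y')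
    (h261 : Ineq261 d' (toB6 (geo9K i) Rr Hp) δ₀ α) (h263 : Ineq263 d' (toB6 (geo9K i) Rr Hp) δ₀ α)
    (hsmall : Θ * B6.c1 d' δ₀ α < 1)
    (hE : ∀ c : ↥(cubes i.D.toDomains), EBlock (kernelFamilyBInv i B cfg (GACubeY i c parS parB) par) B₀ δ₀ U₁)
    (hR : HasMajorant (g := toB6 (geo9K i) Rr Hp) (fun p : FBondY i × ι => ιB (blkV1 i.hN i.D p.1))
      ((∑ c, conj b ((KhBY i (hTY i c) parB (cfg U₁) * GACubeY i c parS parB (cfg U₁) * cutMulY (hBdY i (hTY i c))).restrictScalars ℝ))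
        + ∑ c, conj b (((1 - cutMulY (hBdY i (ζ c))) * DPDsY i parS Gp (cfg U₁) *
            (cutMulY (hBdY i (hTY i c)) * GACubeY i c parS parB (cfg U₁) * cutMulY (hBdY i (hTY i c)))).restrictScalars ℝ)
        + ∑ c, conj b ((cutMulY (hBdY i (ζ c)) * (DPDsY i parS Gp (cfg U₁) - DPDsCubeY i c parS (cfg U₁)) *
            (cutMulY (hBdY i (hTY i c)) * GACubeY i c parS parB (cfg U₁) * cutMulY (hBdY i (hTY i c)))).restrictScalars ℝ)
        + ∑ c, conj b ((cutMulY (hBdY i (ζ c)) * P1CubeY i c (hTY i c) parS (cfg U₁) * GACubeY i c parS parB (cfg U₁) *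
            cutMulY (hBdY i (hTY i c))).restrictScalars ℝ))
      (fun a a' => Θ * Real.exp (-(δ₀ * (geo9K i).dist a a')))) :
    HasMajorant (g := toB6 (geo9K i) Rr Hp) (fun p : FBondY i × ι => ιB (blkV1 i.hN i.D p.1))
      (conj b ((GAY i parS parB Gp (cfg U₁)).restrictScalars ℝ))
      (fun a a' => (3 * 5 ^ (d + 1)) * (M₂ * (∑ j, ‖b j‖) * B₀) * B6.c1 d' δ₀ α * (1 - Θ * B6.c1 d' δ₀ α)⁻¹ * (geo9K i).len a ^ 2 *
        Real.exp (-((1 - α) * δ₀ * (geo9K i).dist a a'))) := by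
  have hSb : 0 ≤ ∑ j, ‖b j‖ := Finset.sum_nonneg fun _ _ => norm_nonneg _
  exact hasMajorant_conj_GAY_of_cubes i b ιB d' parS parB Gp (cfg U₁) ζ hζ hinvC hinvU (SQT i) (mul_nonneg (mul_nonneg hM₂ hSb) hB₀) hΘ
    (by positivity) hαδ htri hrefl hdnn h261 h263 hsmall (fun c => hT_of_eBlockInvB_cube i b ιB cfg hι hM₂ hrepr (GACubeY i c parS parB) par hB₀ (hE c) c)
    (hcnt_SQT i) hR

end Cover

/-! ## §5 The majorant WRITTEN back: (3.42)₁ for `G(U)` pointwise over the bond test class, and the `e 0` entry of `kernelFamilyBInv` -/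

section Write

variable {B : B9.Backgrounds} (cfg : B.Cfg → CfgY 𝔸 i) {U₁ : B.Cfg}

omit [CompleteSpace 𝔸] [DecidableEq ι] [DecidableEq (geo9K i).Site] in
/-- **(2.51) WRITTEN THROUGH COORDINATES AT A BLOCK**: a majorant `C·ℓ(a)²·e^{−δ′d(a,a′)}` of `conj b G` bounds `‖(GΛ)(x)‖` for every `Λ ∈ TestY 𝔸 J`,
`supp J ⊂ Δ(βy′)`, `x ∈ Δ(βy)`, by `(Σ_j‖b_j‖)·C·ℓ(y)²·e^{−δ′d(y,y′)}·M₂|J|` (`B9CubeLettersInvWriteDictB.norm_apply_le_of_hasMajorant_testYB`, indices read at `β`).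
[cite: Balaban1984PropagatorsII, (2.51) p.232; Balaban1985BackgroundPropagators, Thm 3.3 p.399 with (3.39) + (3.42)₁ p.397] -/
theorem norm_apply_le_of_hasMajorantB (hι : ∀ s, β i.hN i.D i.hk (ιB s) = s)
    {M₂ : ℝ} (hM₂ : 0 ≤ M₂) (hrepr : ∀ (v : 𝔸) (j : ι), |b.repr v j| ≤ M₂ * ‖v‖)
    (G : Module.End ℝ (FBondY i → 𝔸)) {C δ' : ℝ}
    (hmaj : HasMajorant (g := toB6 (geo9K i) Rr Hp) (fun p : FBondY i × ι => ιB (blkV1 i.hN i.D p.1)) (conj b G)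
      (fun a a' => C * (geo9K i).len a ^ 2 * Real.exp (-(δ' * (geo9K i).dist a a'))))
    (J : FBondY i → ℝ) (y y' : IBondY i) (hs : (geo9K i).suppIn (Sum.inr J) y') (Λ : TestY 𝔸 J)
    {x : FBondY i} (hx : blkV1 i.hN i.D x = β i.hN i.D i.hk y) :
    ‖G Λ.1 x‖ ≤ (∑ j, ‖b j‖) * (C * (geo9K i).len y ^ 2 * Real.exp (-(δ' * (geo9K i).dist y y'))) * (M₂ * (geo9K i).supNorm (Sum.inr J)) := by
  have hw := norm_apply_le_of_hasMajorant_testYB i b (Rr := Rr) (Hp := Hp) G ιB hM₂ hrepr hmaj J y' hs Λ x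
  rw [geo9K_len_congr i (show β i.hN i.D i.hk (ιB (blkV1 i.hN i.D x)) = β i.hN i.D i.hk y by rw [hι]; exact hx),
    geo9K_dist_congr i (show β i.hN i.D i.hk (ιB (blkV1 i.hN i.D x)) = β i.hN i.D i.hk y by rw [hι]; exact hx) (hι _)] at hw
  exact hw.trans (le_of_eq (by ring))

omit [DecidableEq ι] [DecidableEq (geo9K i).Site] in
/-- **THE `e 0` ENTRY OF THE READING OVER THE CLASS FROM A MAJORANT** (generic bond letter): if `conj b G` has the majorant `C·ℓ²·e^{−δ′d}` (`C ≥ 0`) and `G` agrees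
pointwise with `O(cfg U₁)`, the (3.42)₁ clause of `kernelFamilyBInv i B cfg O par` at `U₁` holds with constant `M₂(Σ_j‖b_j‖)·C` and rate `δ′` (the `n = 0` line of
`B9CubeLettersInvWriteDictB.eBlock_kernelFamilyBInv_of_hasMajorant`, which needs all four entries). [cite: Balaban1985BackgroundPropagators, Thm 3.3 p.399 with (3.42)₁ p.397, (3.39) p.397] -/
theorem e0_kernelFamilyBInv_le_of_hasMajorant (hι : ∀ s, β i.hN i.D i.hk (ιB s) = s)
    {M₂ : ℝ} (hM₂ : 0 ≤ M₂) (hrepr : ∀ (v : 𝔸) (j : ι), |b.repr v j| ≤ M₂ * ‖v‖)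
    (O : BondOpY 𝔸 i) (par : BondParY 𝔸 i) (G : Module.End ℝ (FBondY i → 𝔸)) (hG : ∀ Λ, G Λ = O (cfg U₁) Λ) {C δ' : ℝ} (hC : 0 ≤ C)
    (hmaj : HasMajorant (g := toB6 (geo9K i) Rr Hp) (fun p : FBondY i × ι => ιB (blkV1 i.hN i.D p.1)) (conj b G)
      (fun a a' => C * (geo9K i).len a ^ 2 * Real.exp (-(δ' * (geo9K i).dist a a'))))
    (lam : (geo9K i).Loc) (y y' : IBondY i) (hs : (geo9K i).suppIn lam y') :
    (kernelFamilyBInv i B cfg O par).e 0 U₁ lam y ≤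
      M₂ * (∑ j, ‖b j‖) * C * (geo9K i).len y ^ 2 * Real.exp (-(δ' * (geo9K i).dist y y')) * (geo9K i).supNorm lam := by
  have hSb : 0 ≤ ∑ j, ‖b j‖ := Finset.sum_nonneg fun _ _ => norm_nonneg _
  have hRHS : 0 ≤ M₂ * (∑ j, ‖b j‖) * C * (geo9K i).len y ^ 2 * Real.exp (-(δ' * (geo9K i).dist y y')) * (geo9K i).supNorm lam :=
    mul_nonneg (mul_nonneg (mul_nonneg (mul_nonneg (mul_nonneg hM₂ hSb) hC) (sq_nonneg _)) (Real.exp_pos _).le) (geo9K_supNorm_nonneg i lam)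
  cases lam with
  | inl f => exact hRHS
  | inr J =>
    show (⨆ Λ : TestY 𝔸 J, supInB i (β i.hN i.D i.hk y) (O (cfg U₁) Λ.1)) ≤ _
    refine iSup_testY_le (fun Λ => ?_) hRHS
    refine supInB_le i _ _ hRHS fun x hx => ?_
    have hw := norm_apply_le_of_hasMajorantB i b ιB hι hM₂ hrepr G hmaj J y y' hs Λ hx
    rw [hG] at hw
    exact hw.trans (le_of_eq (by ring))

/-- ★★★ **(3.42)₁ FOR def-Y's `G(U)`, POINTWISE OVER THE BOND TEST CLASS, AT THE CUBE COVER OF RECORD**: under the hypotheses of `hasMajorant_conj_GAY_of_cubeCover`,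
every `Λ ∈ TestY 𝔸 J` with `supp J ⊂ Δ(βy′)` has `‖(G(U)Λ)(x)‖ ≤ (Σ_j‖b_j‖)·C·ℓ(y)²·e^{−(1−α)δ₀d(y,y′)}·M₂|J|` for `x ∈ Δ(βy)`,
`C = 3·5^{d+1}·M₂(Σ‖b_j‖)B₀·c₁(α)(1 − Θc₁(α))⁻¹` (p. 416 «Theorem 3.10 implies Theorem 3.3»; p. 403 «of course with different constants»).
[cite: Balaban1985BackgroundPropagators, Thm 3.3 p.399 (3.42)₁ p.397 via Thm 3.10 pp.414–416] -/
theorem norm_GAY_apply_le_of_cubeCover (hι : ∀ s, β i.hN i.D i.hk (ιB s) = s)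
    {M₂ : ℝ} (hM₂ : 0 ≤ M₂) (hrepr : ∀ (v : 𝔸) (j : ι), |b.repr v j| ≤ M₂ * ‖v‖)
    (d' : ℕ) {δ₀ α Θ B₀ : ℝ}
    (parS : SiteParY 𝔸 i) (parB : BondParY 𝔸 i) (Gp : SiteOpY 𝔸 i) (par : BondParY 𝔸 i)
    (ζ : ↥(cubes i.D.toDomains) → SiteY i → ℝ) (hζ : ∀ c z, hTY i c z ≠ 0 → ζ c z = 1)
    (hinvC : ∀ c : ↥(cubes i.D.toDomains), IsUnit (deltaACubeY i c parS parB (cfg U₁))) (hinvU : IsUnit (deltaAY i parS parB Gp (cfg U₁)))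
    (hB₀ : 0 ≤ B₀) (hΘ : 0 ≤ Θ) (hαδ : 0 ≤ (1 - α) * δ₀)
    (htri : Triangle254 (toB6 (geo9K i) Rr Hp)) (hrefl : ∀ y : (geo9K i).Site, (geo9K i).dist y y = 0)
    (hdnn : ∀ y y' : (geo9K i).Site, 0 ≤ (geo9K i).dist y y')
    (h261 : Ineq261 d' (toB6 (geo9K i) Rr Hp) δ₀ α) (h263 : Ineq263 d' (toB6 (geo9K i) Rr Hp) δ₀ α)
    (hsmall : Θ * B6.c1 d' δ₀ α < 1)
    (hE : ∀ c : ↥(cubes i.D.toDomains), EBlock (kernelFamilyBInv i B cfg (GACubeY i c parS parB) par) B₀ δ₀ U₁)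
    (hR : HasMajorant (g := toB6 (geo9K i) Rr Hp) (fun p : FBondY i × ι => ιB (blkV1 i.hN i.D p.1))
      ((∑ c, conj b ((KhBY i (hTY i c) parB (cfg U₁) * GACubeY i c parS parB (cfg U₁) * cutMulY (hBdY i (hTY i c))).restrictScalars ℝ))
        + ∑ c, conj b (((1 - cutMulY (hBdY i (ζ c))) * DPDsY i parS Gp (cfg U₁) *
            (cutMulY (hBdY i (hTY i c)) * GACubeY i c parS parB (cfg U₁) * cutMulY (hBdY i (hTY i c)))).restrictScalars ℝ)
        + ∑ c, conj b ((cutMulY (hBdY i (ζ c)) * (DPDsY i parS Gp (cfg U₁) - DPDsCubeY i c parS (cfg U₁)) *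
            (cutMulY (hBdY i (hTY i c)) * GACubeY i c parS parB (cfg U₁) * cutMulY (hBdY i (hTY i c)))).restrictScalars ℝ)
        + ∑ c, conj b ((cutMulY (hBdY i (ζ c)) * P1CubeY i c (hTY i c) parS (cfg U₁) * GACubeY i c parS parB (cfg U₁) *
            cutMulY (hBdY i (hTY i c))).restrictScalars ℝ))
      (fun a a' => Θ * Real.exp (-(δ₀ * (geo9K i).dist a a'))))
    (J : FBondY i → ℝ) (y y' : IBondY i) (hs : (geo9K i).suppIn (Sum.inr J) y') (Λ : TestY 𝔸 J)
    {x : FBondY i} (hx : blkV1 i.hN i.D x = β i.hN i.D i.hk y) :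
    ‖GAY i parS parB Gp (cfg U₁) Λ.1 x‖ ≤ (∑ j, ‖b j‖) *
      ((3 * 5 ^ (d + 1)) * (M₂ * (∑ j, ‖b j‖) * B₀) * B6.c1 d' δ₀ α * (1 - Θ * B6.c1 d' δ₀ α)⁻¹ * (geo9K i).len y ^ 2 *
        Real.exp (-((1 - α) * δ₀ * (geo9K i).dist y y'))) * (M₂ * (geo9K i).supNorm (Sum.inr J)) :=
  norm_apply_le_of_hasMajorantB i b ιB hι hM₂ hrepr ((GAY i parS parB Gp (cfg U₁)).restrictScalars ℝ)
    (hasMajorant_conj_GAY_of_cubeCover i b ιB cfg hι hM₂ hrepr d' parS parB Gp par ζ hζ hinvC hinvU hB₀ hΘ hαδ htri hrefl hdnn h261 h263 hsmall hE hR)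
    J y y' hs Λ hx

/-- ★★★ **THE `e 0` ENTRY ((3.42)₁) OF def-Y's READING `kernelFamilyBInv … (GAY i parS parB Gp) …` OVER THE CLASS AT `U₁`, FROM THE CUBE COVER**: constant
`M₂(Σ_j‖b_j‖)·3·5^{d+1}·M₂(Σ_j‖b_j‖)B₀·c₁(α)(1 − Θc₁(α))⁻¹`, rate `(1−α)δ₀` — Theorem 3.3's first inequality for `G(U)` at def-Y's letters with its hypotheses
displayed as in `hasMajorant_conj_GAY_of_cubeCover`. [cite: Balaban1985BackgroundPropagators, Thm 3.3 p.399 (3.42)₁ p.397 via Thm 3.10 pp.414–416] -/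
theorem e0_kernelFamilyBInv_GAY_le_of_cubeCover (hι : ∀ s, β i.hN i.D i.hk (ιB s) = s)
    {M₂ : ℝ} (hM₂ : 0 ≤ M₂) (hrepr : ∀ (v : 𝔸) (j : ι), |b.repr v j| ≤ M₂ * ‖v‖)
    (d' : ℕ) {δ₀ α Θ B₀ : ℝ}
    (parS : SiteParY 𝔸 i) (parB : BondParY 𝔸 i) (Gp : SiteOpY 𝔸 i) (par : BondParY 𝔸 i)
    (ζ : ↥(cubes i.D.toDomains) → SiteY i → ℝ) (hζ : ∀ c z, hTY i c z ≠ 0 → ζ c z = 1)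
    (hinvC : ∀ c : ↥(cubes i.D.toDomains), IsUnit (deltaACubeY i c parS parB (cfg U₁))) (hinvU : IsUnit (deltaAY i parS parB Gp (cfg U₁)))
    (hB₀ : 0 ≤ B₀) (hΘ : 0 ≤ Θ) (hαδ : 0 ≤ (1 - α) * δ₀)
    (htri : Triangle254 (toB6 (geo9K i) Rr Hp)) (hrefl : ∀ y : (geo9K i).Site, (geo9K i).dist y y = 0)
    (hdnn : ∀ y y' : (geo9K i).Site, 0 ≤ (geo9K i).dist y y')
    (h261 : Ineq261 d' (toB6 (geo9K i) Rr Hp) δ₀ α) (h263 : Ineq263 d' (toB6 (geo9K i) Rr Hp) δ₀ α)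
    (hsmall : Θ * B6.c1 d' δ₀ α < 1)
    (hE : ∀ c : ↥(cubes i.D.toDomains), EBlock (kernelFamilyBInv i B cfg (GACubeY i c parS parB) par) B₀ δ₀ U₁)
    (hR : HasMajorant (g := toB6 (geo9K i) Rr Hp) (fun p : FBondY i × ι => ιB (blkV1 i.hN i.D p.1))
      ((∑ c, conj b ((KhBY i (hTY i c) parB (cfg U₁) * GACubeY i c parS parB (cfg U₁) * cutMulY (hBdY i (hTY i c))).restrictScalars ℝ))
        + ∑ c, conj b (((1 - cutMulY (hBdY i (ζ c))) * DPDsY i parS Gp (cfg U₁) *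
            (cutMulY (hBdY i (hTY i c)) * GACubeY i c parS parB (cfg U₁) * cutMulY (hBdY i (hTY i c)))).restrictScalars ℝ)
        + ∑ c, conj b ((cutMulY (hBdY i (ζ c)) * (DPDsY i parS Gp (cfg U₁) - DPDsCubeY i c parS (cfg U₁)) *
            (cutMulY (hBdY i (hTY i c)) * GACubeY i c parS parB (cfg U₁) * cutMulY (hBdY i (hTY i c)))).restrictScalars ℝ)
        + ∑ c, conj b ((cutMulY (hBdY i (ζ c)) * P1CubeY i c (hTY i c) parS (cfg U₁) * GACubeY i c parS parB (cfg U₁) *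
            cutMulY (hBdY i (hTY i c))).restrictScalars ℝ))
      (fun a a' => Θ * Real.exp (-(δ₀ * (geo9K i).dist a a'))))
    (lam : (geo9K i).Loc) (y y' : IBondY i) (hs : (geo9K i).suppIn lam y') :
    (kernelFamilyBInv i B cfg (GAY i parS parB Gp) par).e 0 U₁ lam y ≤
      M₂ * (∑ j, ‖b j‖) * ((3 * 5 ^ (d + 1)) * (M₂ * (∑ j, ‖b j‖) * B₀) * B6.c1 d' δ₀ α * (1 - Θ * B6.c1 d' δ₀ α)⁻¹) *
        (geo9K i).len y ^ 2 * Real.exp (-((1 - α) * δ₀ * (geo9K i).dist y y')) * (geo9K i).supNorm lam := by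
  have hSb : 0 ≤ ∑ j, ‖b j‖ := Finset.sum_nonneg fun _ _ => norm_nonneg _
  have hC : 0 ≤ (3 * 5 ^ (d + 1)) * (M₂ * (∑ j, ‖b j‖) * B₀) * B6.c1 d' δ₀ α * (1 - Θ * B6.c1 d' δ₀ α)⁻¹ :=
    mul_nonneg (mul_nonneg (mul_nonneg (by positivity) (mul_nonneg (mul_nonneg hM₂ hSb) hB₀)) (B6RandomWalk.c1_nonneg d' δ₀ α))
      (inv_nonneg.2 (sub_nonneg.2 hsmall.le))
  exact e0_kernelFamilyBInv_le_of_hasMajorant i b ιB cfg hι hM₂ hrepr (GAY i parS parB Gp) par ((GAY i parS parB Gp (cfg U₁)).restrictScalars ℝ)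
    (fun _ => rfl) hC
    (hasMajorant_conj_GAY_of_cubeCover i b ιB cfg hι hM₂ hrepr d' parS parB Gp par ζ hζ hinvC hinvU hB₀ hΘ hαδ htri hrefl hdnn h261 h263 hsmall hE hR)
    lam y y' hs

end Write

end Literature.MathematicalPhysics.QuantumFieldTheory.Balaban1983to89.B9Thm310GTorusRegular

end
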